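import Summits.AtomisticToContinuum.Crystallization.Theorems.ShellsToBarlowChart.Negative.Tolerance
import Summits.AtomisticToContinuum.Crystallization.Theorems.PalmUnimodularRigidityShellsToBarlowChartDefs
import Summits.AtomisticToContinuum.Crystallization.Theorems.PalmUnimodularRigidityShellsToBarlowChartTransportDefs
import Literature.Geometry.DiscreteGeometry.KissingRigidity
import Literature.Geometry.DiscreteGeometry.LayerShellPatterns

/-!
# Integer charts and the transfer lemma (line `develop-the-model-growth-descent`, stub `stub_transportSystem`, part 1)

Crux `ShellsToBarlowChart` (stmt-AtomisticToContinuum-9227), route `PalmUnimodularRigidity`.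
The geometric half of the development reads every shell through INTEGER labels: both kissing
patterns are placed in `ℤ³` at squared norm `18` (`fcc3Int = 3 · fccInt`, `hcpInt`), a chart at
`x` (`IsZChart`) labels the bonded neighbours of `x` bijectively by the pattern with each
neighbour within `a/100` of its ideal position `x + (a/√18) A t`, and bonds among neighbours are
exactly the label pairs at squared distance `18`.  This file proves:

* `isZChart_of_localChart` — every `LocalChart` (stub `stub_localCharts`) gives an integer chart;
* elementary metric consequences (`dist_nbr_ideal`, distances between labelled points are
  `a·√(D/18) ± a/50` with `D = sqNormInt (t − t')`);
* **the transfer lemma** `sqNormInt_transfer`: for two bonded sites `x ~ y` with charts and two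
  points `z, z'` that are `x`, `y` or common neighbours, the squared label distance of `z, z'` is
  the SAME in both charts.  This is the only place where the `1 %` tolerance is spent in the
  whole development: the label spectrum `√(D/18) ∈ {0, 1, √2, √(8/3), √3, √(11/3), 2}` has
  consecutive gaps `99 q − 101 p > 4` (worst: `2` vs `√(11/3)`, `4.60`), against the budget
  `4/99·a` of two `a/50` readings at scales tied by `99 aₓ ≤ 101 a_y` (cf. the disprover's
  `equatorPropagation_margin`, which is the pair `√(8/3)` vs `√3`).
-/

noncomputable section

namespace Summit.AtomisticToContinuum.Crystallization.Theorems.PalmUnimodularRigidityShellsToBarlowChart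

open Literature.Geometry.DiscreteGeometry Literature.MathematicalPhysics.StatisticalMechanics
open Summit.AtomisticToContinuum.Crystallization.Theorems.ShellsToBarlowChartNegative

/-- Euclidean `3`-space. -/
local notation "E3" => EuclideanSpace ℝ (Fin 3)


/-! ## Pattern facts in `ℤ³` (all by `decide`) -/

/-- `fcc3Int` is `3 · fccInt`. [folklore] -/
theorem fcc3Int_eq_image : fcc3Int = fccInt.image (fun v => (3 : ℤ) • v) := by decide

/-- Labels of `fcc3Int` have squared norm `18`. [folklore] -/
theorem sqNormInt_of_mem_fcc3Int : ∀ t ∈ fcc3Int, sqNormInt t = 18 := by decide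

/-- Labels of `hcpInt` have squared norm `18`. [folklore] -/
theorem sqNormInt_of_mem_hcpInt : ∀ t ∈ hcpInt, sqNormInt t = 18 := by decide

/-- The label spectrum of `fcc3Int`: squared distances of two labels lie in
`{0, 18, 36, 54, 72}` (`⊆ {0, 18, 36, 48, 54, 66, 72}`). [cite: ConwaySloane1999, Ch. 4 §6.3] -/
theorem sqNormInt_sub_mem_fcc3Int : ∀ t ∈ fcc3Int, ∀ t' ∈ fcc3Int,
    sqNormInt (t - t') ∈ ({0, 18, 36, 48, 54, 66, 72} : Finset ℤ) := by decide

/-- The label spectrum of `hcpInt`: squared distances of two labels lie in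
`{0, 18, 36, 48, 54, 66, 72}`. [cite: HalesDSP2012, §1.3] -/
theorem sqNormInt_sub_mem_hcpInt : ∀ t ∈ hcpInt, ∀ t' ∈ hcpInt,
    sqNormInt (t - t') ∈ ({0, 18, 36, 48, 54, 66, 72} : Finset ℤ) := by decide

/-- Squared norms of integer vectors are non-negative. [folklore] -/
theorem sqNormInt_nonneg (v : Fin 3 → ℤ) : 0 ≤ sqNormInt v := by
  unfold sqNormInt; positivity

/-- `sqNormInt` is even. [folklore] -/
theorem sqNormInt_neg (v : Fin 3 → ℤ) : sqNormInt (-v) = sqNormInt v := by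
  unfold sqNormInt; simp only [Pi.neg_apply]; ring

/-- `sqNormInt (v - w) = sqNormInt (w - v)`. [folklore] -/
theorem sqNormInt_sub_comm (v w : Fin 3 → ℤ) : sqNormInt (v - w) = sqNormInt (w - v) := by
  rw [← sqNormInt_neg, neg_sub]

/-! ## The two real patterns are the integer patterns scaled by `1/√18` -/

/-- The scaling map `t ↦ intVec t / √18`. (Local abbreviation used only inside statements.)
[folklore] -/
theorem scale18_injective : Function.Injective fun t : Fin 3 → ℤ => ((Real.sqrt 18)⁻¹ • intVec t : E3) :=
  scaledPattern_map_injective (N := 18) (by norm_num)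

/-- `fccKissingPattern` is `fcc3Int` scaled by `1/√18`. [cite: ConwaySloane1999, Ch. 4 §6.3] -/
theorem fccKissingPattern_eq_scaledPattern_fcc3Int : fccKissingPattern = scaledPattern fcc3Int 18 := by
  rw [fccKissingPattern, scaledPattern, scaledPattern, fcc3Int_eq_image, Finset.image_image]
  refine Finset.image_congr fun v _ => ?_
  show (Real.sqrt (2 : ℕ))⁻¹ • intVec v = (Real.sqrt (18 : ℕ))⁻¹ • intVec ((3 : ℤ) • v)
  rw [intVec_zsmul, smul_smul]
  congr 1
  have h2 : (0 : ℝ) < Real.sqrt 2 := by positivity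
  push_cast
  rw [sqrt_eighteen_eq]
  field_simp

/-- `hcpKissingPattern` is `hcpInt` scaled by `1/√18` (by definition). [cite: HalesDSP2012, §1.3] -/
theorem hcpKissingPattern_eq_scaledPattern_hcpInt : hcpKissingPattern = scaledPattern hcpInt 18 := rfl

/-- Distance of two scaled labels: `‖t/√18 − t'/√18‖ = √(sqNormInt (t − t')) / √18`. [folklore] -/
theorem dist_scale18 (t t' : Fin 3 → ℤ) :
    dist ((Real.sqrt 18)⁻¹ • intVec t : E3) ((Real.sqrt 18)⁻¹ • intVec t') =
      (Real.sqrt 18)⁻¹ * Real.sqrt (sqNormInt (t - t') : ℝ) := by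
  rw [dist_eq_norm, ← smul_sub, intVec_sub, norm_smul, norm_inv, Real.norm_of_nonneg (Real.sqrt_nonneg _),
    norm_intVec]

/-- Two scaled labels are at distance `1` iff the labels are at squared distance `18`. [folklore] -/
theorem dist_scale18_eq_one_iff (t t' : Fin 3 → ℤ) :
    dist ((Real.sqrt 18)⁻¹ • intVec t : E3) ((Real.sqrt 18)⁻¹ • intVec t') = 1 ↔ sqNormInt (t - t') = 18 := by
  rw [dist_scale18]
  have h18 : (0 : ℝ) < Real.sqrt 18 := by positivity
  rw [inv_mul_eq_iff_eq_mul₀ h18.ne', mul_one]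
  constructor
  · intro h
    have h2 : ((sqNormInt (t - t') : ℤ) : ℝ) = 18 := by
      have hnn : (0 : ℝ) ≤ (sqNormInt (t - t') : ℝ) := by exact_mod_cast sqNormInt_nonneg _
      have h3 : Real.sqrt (sqNormInt (t - t') : ℝ) ^ 2 = Real.sqrt 18 ^ 2 := by rw [h]
      rwa [Real.sq_sqrt hnn, Real.sq_sqrt (by norm_num)] at h3
    exact_mod_cast h2
  · intro h
    rw [h]; norm_num

/-! ## Integer charts from local charts -/

/-- **Every local chart gives an integer chart.**  Compose the labelling `e` of `LocalChart S x`
with the scaling `t ↦ t/√18` of the integer pattern (`fcc3Int` for the FCC pattern, `hcpInt`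
for the HCP pattern). [folklore] -/
theorem isZChart_of_localChart {S : Set E3} {x : E3} (h : LocalChart S x) :
    ∃ (a : ℝ) (P : Finset (Fin 3 → ℤ)) (A : E3 →ₗᵢ[ℝ] E3) (nbr : (Fin 3 → ℤ) → E3),
      IsZChart S x a P A nbr := by
  obtain ⟨a, ha9, ha1, Pr, hPr, A, e, hbij, hclose, hlink⟩ := h
  -- the integer pattern behind `Pr`
  obtain ⟨P, hP, hPrP⟩ : ∃ P : Finset (Fin 3 → ℤ), (P = fcc3Int ∨ P = hcpInt) ∧ Pr = scaledPattern P 18 := by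
    rcases hPr with rfl | rfl
    · exact ⟨fcc3Int, Or.inl rfl, fccKissingPattern_eq_scaledPattern_fcc3Int⟩
    · exact ⟨hcpInt, Or.inr rfl, hcpKissingPattern_eq_scaledPattern_hcpInt⟩
  have hPr_coe : (↑Pr : Set E3) = (fun t : Fin 3 → ℤ => ((Real.sqrt 18)⁻¹ • intVec t : E3)) '' ↑P := by
    rw [hPrP, scaledPattern, Finset.coe_image]; rfl
  have hsc_mem : ∀ t ∈ P, ((Real.sqrt 18)⁻¹ • intVec t : E3) ∈ Pr := fun t ht => by
    rw [hPrP, scaledPattern]; exact Finset.mem_image_of_mem _ ht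
  refine ⟨a, P, A, fun t => e ((Real.sqrt 18)⁻¹ • intVec t), hP, ha9, ha1, ?_, ?_, ?_⟩
  · -- bijection
    have hsc_bij : Set.BijOn (fun t : Fin 3 → ℤ => ((Real.sqrt 18)⁻¹ • intVec t : E3)) ↑P ↑Pr := by
      rw [hPr_coe]; exact (scale18_injective.injOn).bijOn_image
    exact hbij.comp hsc_bij
  · -- closeness
    intro t ht
    have h1 := hclose _ (hsc_mem t ht)
    rw [LinearIsometry.map_smul, smul_smul] at h1
    exact h1
  · -- links
    intro t ht t' ht'
    have h1 := hlink _ (hsc_mem t ht) _ (hsc_mem t' ht')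
    rw [dist_scale18_eq_one_iff] at h1
    exact ⟨fun hb => h1.2 hb, fun hs => h1.1 hs⟩


/-! ## Metric consequences of an integer chart -/

section ChartFacts

variable {S : Set E3} {x : E3} {a : ℝ} {P : Finset (Fin 3 → ℤ)} {A : E3 →ₗᵢ[ℝ] E3}
  {nbr : (Fin 3 → ℤ) → E3}

/-- The label spectrum `{0, 18, 36, 48, 54, 66, 72}` (as a `Finset ℤ`, written out in every
statement; this lemma records membership of `18`). [folklore] -/
theorem eighteen_mem_spectrum : (18 : ℤ) ∈ ({0, 18, 36, 48, 54, 66, 72} : Finset ℤ) := by decide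

/-- Labels of a chart have squared norm `18`. [folklore] -/
theorem IsZChart.sqNormInt_eq (h : IsZChart S x a P A nbr) {t : Fin 3 → ℤ} (ht : t ∈ P) :
    sqNormInt t = 18 := by
  rcases h.1 with rfl | rfl
  · exact sqNormInt_of_mem_fcc3Int t ht
  · exact sqNormInt_of_mem_hcpInt t ht

/-- Squared label distances of a chart lie in the spectrum. [folklore] -/
theorem IsZChart.sqNormInt_sub_mem (h : IsZChart S x a P A nbr) {t t' : Fin 3 → ℤ} (ht : t ∈ P)
    (ht' : t' ∈ P) : sqNormInt (t - t') ∈ ({0, 18, 36, 48, 54, 66, 72} : Finset ℤ) := by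
  rcases h.1 with rfl | rfl
  · exact sqNormInt_sub_mem_fcc3Int t ht t' ht'
  · exact sqNormInt_sub_mem_hcpInt t ht t' ht'

/-- The scale of a chart is positive. [folklore] -/
theorem IsZChart.pos (h : IsZChart S x a P A nbr) : 0 < a := by linarith [h.2.1]

/-- Norm of an ideal label vector: `‖(a/√18) A t‖ = (a/√18) √(sqNormInt t)`. [folklore] -/
theorem norm_ideal (ha : 0 ≤ a) (A : E3 →ₗᵢ[ℝ] E3) (t : Fin 3 → ℤ) :
    ‖(a * (Real.sqrt 18)⁻¹) • A (intVec t)‖ = a * (Real.sqrt 18)⁻¹ * Real.sqrt (sqNormInt t : ℝ) := by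
  rw [norm_smul, LinearIsometry.norm_map, norm_intVec, Real.norm_of_nonneg (by positivity)]

/-- Distance of two ideal label positions: `(a/√18) √(sqNormInt (t − t'))`. [folklore] -/
theorem dist_ideal (ha : 0 ≤ a) (x : E3) (A : E3 →ₗᵢ[ℝ] E3) (t t' : Fin 3 → ℤ) :
    dist (x + (a * (Real.sqrt 18)⁻¹) • A (intVec t)) (x + (a * (Real.sqrt 18)⁻¹) • A (intVec t')) =
      a * (Real.sqrt 18)⁻¹ * Real.sqrt (sqNormInt (t - t') : ℝ) := by
  rw [dist_eq_norm, add_sub_add_left_eq_sub, ← smul_sub, ← map_sub, intVec_sub, norm_ideal ha]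

/-- A point carrying the extended label `t` at `x` (`t = 0` for `x` itself, else the neighbour
labelled `t`) is within `a/100` of the ideal position of `t`. [folklore] -/
theorem IsZChart.dist_xlabel_ideal (h : IsZChart S x a P A nbr) {z : E3} {t : Fin 3 → ℤ}
    (hz : (t = 0 ∧ z = x) ∨ (t ∈ P ∧ z = nbr t)) :
    dist z (x + (a * (Real.sqrt 18)⁻¹) • A (intVec t)) ≤ a / 100 := by
  rcases hz with ⟨rfl, rfl⟩ | ⟨ht, rfl⟩
  · have h0 : intVec (0 : Fin 3 → ℤ) = 0 := by ext i; simp [intVec]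
    rw [h0, map_zero, smul_zero, add_zero, dist_self]
    linarith [h.pos]
  · exact h.2.2.2.2.1 t ht

/-- Extended labels have squared distances in the spectrum. [folklore] -/
theorem IsZChart.xlabel_sub_mem (h : IsZChart S x a P A nbr) {z z' : E3} {t t' : Fin 3 → ℤ}
    (hz : (t = 0 ∧ z = x) ∨ (t ∈ P ∧ z = nbr t)) (hz' : (t' = 0 ∧ z' = x) ∨ (t' ∈ P ∧ z' = nbr t')) :
    sqNormInt (t - t') ∈ ({0, 18, 36, 48, 54, 66, 72} : Finset ℤ) := by
  rcases hz with ⟨rfl, -⟩ | ⟨ht, -⟩ <;> rcases hz' with ⟨rfl, -⟩ | ⟨ht', -⟩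
  · decide
  · rw [zero_sub, sqNormInt_neg, h.sqNormInt_eq ht']; decide
  · rw [sub_zero, h.sqNormInt_eq ht]; decide
  · exact h.sqNormInt_sub_mem ht ht'

/-- **Reading a distance in a chart**: two points with extended labels `t, t'` at `x` are at
distance `(a/√18)·√(sqNormInt (t − t')) ± a/50`. [folklore] -/
theorem IsZChart.abs_dist_sub_reading_le (h : IsZChart S x a P A nbr) {z z' : E3} {t t' : Fin 3 → ℤ}
    (hz : (t = 0 ∧ z = x) ∨ (t ∈ P ∧ z = nbr t)) (hz' : (t' = 0 ∧ z' = x) ∨ (t' ∈ P ∧ z' = nbr t')) :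
    |dist z z' - a * (Real.sqrt 18)⁻¹ * Real.sqrt (sqNormInt (t - t') : ℝ)| ≤ a / 50 := by
  have h1 := h.dist_xlabel_ideal hz
  have h2 := h.dist_xlabel_ideal hz'
  rw [← dist_ideal h.pos.le x A t t']
  set p : E3 := x + (a * (Real.sqrt 18)⁻¹) • A (intVec t)
  set p' : E3 := x + (a * (Real.sqrt 18)⁻¹) • A (intVec t')
  have e1 : |dist z z' - dist p z'| ≤ dist z p := _root_.abs_dist_sub_le z p z'
  have e2 : |dist z' p - dist p' p| ≤ dist z' p' := _root_.abs_dist_sub_le z' p' p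
  rw [dist_comm z' p, dist_comm p' p] at e2
  rw [abs_le] at e1 e2 ⊢
  constructor <;> linarith [e1.1, e1.2, e2.1, e2.2]

/-- A bonded neighbour of the centre carries a label. [folklore] -/
theorem IsZChart.exists_label (h : IsZChart S x a P A nbr) {y : E3} (hy : y ∈ S)
    (hb : 0 < dist x y ∧ dist x y ≤ 28 / 25) : ∃ t ∈ P, y = nbr t := by
  obtain ⟨t, ht, rfl⟩ := h.2.2.2.1.surjOn ⟨hy, hb⟩
  exact ⟨t, ht, rfl⟩

/-- A labelled neighbour is in `S` and bonded to the centre. [folklore] -/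
theorem IsZChart.nbr_mem (h : IsZChart S x a P A nbr) {t : Fin 3 → ℤ} (ht : t ∈ P) :
    nbr t ∈ S ∧ (0 < dist x (nbr t) ∧ dist x (nbr t) ≤ 28 / 25) :=
  h.2.2.2.1.mapsTo ht

/-- Distance from the centre to a labelled neighbour: within `a/100` of `a`. [folklore] -/
theorem IsZChart.abs_dist_nbr_sub_le (h : IsZChart S x a P A nbr) {t : Fin 3 → ℤ} (ht : t ∈ P) :
    |dist x (nbr t) - a| ≤ a / 100 := by
  have h1 := h.dist_xlabel_ideal (Or.inr ⟨ht, rfl⟩)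
  have hn : ‖(a * (Real.sqrt 18)⁻¹) • A (intVec t)‖ = a := by
    rw [norm_ideal h.pos.le, h.sqNormInt_eq ht]
    push_cast
    rw [mul_assoc, inv_mul_cancel₀ (by positivity), mul_one]
  have h2 : dist x (x + (a * (Real.sqrt 18)⁻¹) • A (intVec t)) = a := by
    rw [dist_eq_norm, sub_add_cancel_left, norm_neg, hn]
  have e1 : |dist (nbr t) x - dist (x + (a * (Real.sqrt 18)⁻¹) • A (intVec t)) x| ≤
      dist (nbr t) (x + (a * (Real.sqrt 18)⁻¹) • A (intVec t)) := _root_.abs_dist_sub_le _ _ _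
  rw [dist_comm (x + (a * (Real.sqrt 18)⁻¹) • A (intVec t)) x, h2, dist_comm (nbr t) x] at e1
  rw [abs_le] at e1 ⊢
  constructor <;> linarith [e1.1, e1.2]

/-- **Scales of bonded sites are tied**: `99 aₓ ≤ 101 a_y` (and symmetrically) when `y` is a
bonded neighbour of `x` and `x` one of `y`. [folklore] -/
theorem scales_tied {y : E3} {ay : ℝ} {Py : Finset (Fin 3 → ℤ)} {Ay : E3 →ₗᵢ[ℝ] E3}
    {ny : (Fin 3 → ℤ) → E3} (hx : IsZChart S x a P A nbr) (hy : IsZChart S y ay Py Ay ny)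
    (hxS : x ∈ S) (hyx : y ∈ S ∧ (0 < dist x y ∧ dist x y ≤ 28 / 25)) :
    99 * a ≤ 101 * ay ∧ 99 * ay ≤ 101 * a := by
  obtain ⟨t, ht, hyt⟩ := hx.exists_label hyx.1 hyx.2
  have hxy : 0 < dist y x ∧ dist y x ≤ 28 / 25 := by rw [dist_comm]; exact hyx.2
  obtain ⟨u, hu, hxu⟩ := hy.exists_label hxS hxy
  have h1 := hx.abs_dist_nbr_sub_le ht
  have h2 := hy.abs_dist_nbr_sub_le hu
  rw [← hyt] at h1
  rw [← hxu, dist_comm] at h2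
  rw [abs_le] at h1 h2
  constructor <;> linarith [h1.1, h1.2, h2.1, h2.2]

/-! ## The transfer lemma -/

/-- Square-root enclosures for the spectrum. [folklore] -/
theorem sqrt_bounds :
    Real.sqrt 18 < 42427 / 10000 ∧ (42426 / 10000 : ℝ) < Real.sqrt 18 ∧
    Real.sqrt 36 = 6 ∧ (69282 / 10000 : ℝ) < Real.sqrt 48 ∧ Real.sqrt 48 < 69283 / 10000 ∧
    (734846 / 100000 : ℝ) < Real.sqrt 54 ∧ Real.sqrt 54 < 734847 / 100000 ∧
    (812403 / 100000 : ℝ) < Real.sqrt 66 ∧ Real.sqrt 66 < 812404 / 100000 ∧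
    (848528 / 100000 : ℝ) < Real.sqrt 72 ∧ Real.sqrt 72 < 848529 / 100000 := by
  refine ⟨?_, ?_, ?_, ?_, ?_, ?_, ?_, ?_, ?_, ?_, ?_⟩
  · exact (Real.sqrt_lt' (by norm_num)).2 (by norm_num)
  · exact (Real.lt_sqrt (by norm_num)).2 (by norm_num)
  · rw [show (36 : ℝ) = 6 ^ 2 by norm_num, Real.sqrt_sq (by norm_num)]
  · exact (Real.lt_sqrt (by norm_num)).2 (by norm_num)
  · exact (Real.sqrt_lt' (by norm_num)).2 (by norm_num)
  · exact (Real.lt_sqrt (by norm_num)).2 (by norm_num)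
  · exact (Real.sqrt_lt' (by norm_num)).2 (by norm_num)
  · exact (Real.lt_sqrt (by norm_num)).2 (by norm_num)
  · exact (Real.sqrt_lt' (by norm_num)).2 (by norm_num)
  · exact (Real.lt_sqrt (by norm_num)).2 (by norm_num)
  · exact (Real.sqrt_lt' (by norm_num)).2 (by norm_num)

/-- **Spectrum gap**: consecutive values `√p < √q` of the label spectrum satisfy
`99 √q − 101 √p > 4 √18` (worst pair `66, 72`: `19.5 > 16.98`) — two `a/50` readings at scales
tied by `99 aₓ ≤ 101 a_y` can never confuse two spectrum values. [folklore] -/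
theorem spectrum_gap {p q : ℤ} (hp : p ∈ ({0, 18, 36, 48, 54, 66, 72} : Finset ℤ))
    (hq : q ∈ ({0, 18, 36, 48, 54, 66, 72} : Finset ℤ)) (hpq : p < q) :
    4 * Real.sqrt 18 < 99 * Real.sqrt (q : ℝ) - 101 * Real.sqrt (p : ℝ) := by
  obtain ⟨b18u, b18l, b36, b48l, b48u, b54l, b54u, b66l, b66u, b72l, b72u⟩ := sqrt_bounds
  simp only [Finset.mem_insert, Finset.mem_singleton] at hp hq
  rcases hp with rfl | rfl | rfl | rfl | rfl | rfl | rfl <;>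
    rcases hq with rfl | rfl | rfl | rfl | rfl | rfl | rfl <;>
    first
    | (exfalso; omega)
    | (push_cast; (try simp only [Real.sqrt_zero]); nlinarith [Real.sqrt_nonneg 18])

/-- One direction of the transfer argument: if `√D < √D'` in the spectrum then the two readings
`|d − aₓ√D/√18| ≤ aₓ/50`, `|d − a_y√D'/√18| ≤ a_y/50` with `99 aₓ ≤ 101 a_y` are incompatible.
[folklore] -/
theorem transfer_aux {ax ay d : ℝ} {D D' : ℤ} (hax : 0 < ax) (hay : 0 < ay)
    (htie : 99 * ax ≤ 101 * ay)
    (hD : D ∈ ({0, 18, 36, 48, 54, 66, 72} : Finset ℤ)) (hD' : D' ∈ ({0, 18, 36, 48, 54, 66, 72} : Finset ℤ))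
    (hlt : D < D')
    (h1 : |d - ax * (Real.sqrt 18)⁻¹ * Real.sqrt (D : ℝ)| ≤ ax / 50)
    (h2 : |d - ay * (Real.sqrt 18)⁻¹ * Real.sqrt (D' : ℝ)| ≤ ay / 50) : False := by
  have hgap := spectrum_gap hD hD' hlt
  have h18 : (0 : ℝ) < Real.sqrt 18 := by positivity
  rw [abs_le] at h1 h2
  have hD0 : 0 ≤ Real.sqrt (D : ℝ) := Real.sqrt_nonneg _
  -- clear the `√18` denominators
  have e1 : ax * (Real.sqrt 18)⁻¹ * Real.sqrt (D : ℝ) * Real.sqrt 18 = ax * Real.sqrt (D : ℝ) := by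
    field_simp
  have e2 : ay * (Real.sqrt 18)⁻¹ * Real.sqrt (D' : ℝ) * Real.sqrt 18 = ay * Real.sqrt (D' : ℝ) := by
    field_simp
  have k1 : (ay * (Real.sqrt 18)⁻¹ * Real.sqrt (D' : ℝ) - ax * (Real.sqrt 18)⁻¹ * Real.sqrt (D : ℝ)) ≤
      ax / 50 + ay / 50 := by linarith
  have k2 : ay * Real.sqrt (D' : ℝ) - ax * Real.sqrt (D : ℝ) ≤ (ax / 50 + ay / 50) * Real.sqrt 18 := by
    have := mul_le_mul_of_nonneg_right k1 h18.le
    rwa [sub_mul, e1, e2] at this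
  -- `ax √D ≤ (101/99) ay √D`
  have k3 : ax * Real.sqrt (D : ℝ) ≤ 101 / 99 * ay * Real.sqrt (D : ℝ) :=
    mul_le_mul_of_nonneg_right (by linarith) hD0
  have k4 : ay * (99 * Real.sqrt (D' : ℝ) - 101 * Real.sqrt (D : ℝ)) ≤ ay * (4 * Real.sqrt 18) := by
    nlinarith
  have k5 : 99 * Real.sqrt (D' : ℝ) - 101 * Real.sqrt (D : ℝ) ≤ 4 * Real.sqrt 18 :=
    le_of_mul_le_mul_left k4 hay
  linarith

/-- **The transfer lemma** (the only metric input of the development).  Let `x ~ y` be bonded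
sites with integer charts, scales tied by `99 aₓ ≤ 101 a_y`, `99 a_y ≤ 101 aₓ`, and let `z, z'`
be two points each of which is `x` (label `0`) or a labelled neighbour of `x`, AND is `y` or a
labelled neighbour of `y`.  Then the squared label distance of `z, z'` read at `y` equals the one
read at `x`. [folklore] -/
theorem sqNormInt_transfer {y : E3} {ay : ℝ} {Py : Finset (Fin 3 → ℤ)} {Ay : E3 →ₗᵢ[ℝ] E3}
    {ny : (Fin 3 → ℤ) → E3} (hx : IsZChart S x a P A nbr) (hy : IsZChart S y ay Py Ay ny)
    (htie : 99 * a ≤ 101 * ay) (htie' : 99 * ay ≤ 101 * a)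
    {z z' : E3} {t t' u u' : Fin 3 → ℤ}
    (hzx : (t = 0 ∧ z = x) ∨ (t ∈ P ∧ z = nbr t)) (hz'x : (t' = 0 ∧ z' = x) ∨ (t' ∈ P ∧ z' = nbr t'))
    (hzy : (u = 0 ∧ z = y) ∨ (u ∈ Py ∧ z = ny u)) (hz'y : (u' = 0 ∧ z' = y) ∨ (u' ∈ Py ∧ z' = ny u')) :
    sqNormInt (u - u') = sqNormInt (t - t') := by
  have hD := hx.xlabel_sub_mem hzx hz'x
  have hD' := hy.xlabel_sub_mem hzy hz'y
  have h1 := hx.abs_dist_sub_reading_le hzx hz'x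
  have h2 := hy.abs_dist_sub_reading_le hzy hz'y
  rcases lt_trichotomy (sqNormInt (t - t')) (sqNormInt (u - u')) with hlt | heq | hgt
  · exact (transfer_aux hx.pos hy.pos htie hD hD' hlt h1 h2).elim
  · exact heq.symm
  · exact (transfer_aux hy.pos hx.pos htie' hD' hD hgt h2 h1).elim

end ChartFacts

end Summit.AtomisticToContinuum.Crystallization.Theorems.PalmUnimodularRigidityShellsToBarlowChart

end
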